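import Literature.RingTheory.TightClosure.FRationalNormal
import HarnessLib

/-!
# Parameter-F-closed local domains: principal ideals are Frobenius closed

Topic: `Literature/RingTheory/TightClosure`. PROVED (no named facts). A Noetherian local ring is called
*parameter F-closed* when every ideal generated by a (full) system of parameters is Frobenius closed
([QuyShimomoto2017, Def. 3.5]; for Cohen–Macaulay rings this is F-injectivity, Fedder 1983). This file
records the Frobenius-closure analogue of `IsFRational.isTightlyClosed_span_singleton`
(`FRationalNormal.lean`):

* `isFrobeniusClosed_span_singleton_of_parameterFClosed` — in a parameter-F-closed Noetherian local
  DOMAIN every principal ideal is Frobenius closed: a non-zero `x ∈ 𝔪` extends to systems of parameters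
  `x, t₂ⁿ, …, t_dⁿ` for all `n ≥ 1` (`exists_isSystemOfParameters_cons`), so
  `(x)^F ⊆ ⋂ₙ (x, t₂ⁿ, …, t_dⁿ) ⊆ ⋂ₙ (xR + 𝔪ⁿ) = xR` by Krull's intersection theorem in `R/xR`.
  (Equivalently: such a domain is weakly normal in the sense `y^q ∈ x^q R ⇒ y ∈ xR`; cf. Schwede 2009,
  "F-injective singularities are weakly normal", for the F-injective case.)
* `span_singleton_frobeniusClosed_of_fInjective_clause` — the same in the inline vocabulary of route
  `FrobeniusLadder` (summit `ResolutionOfSingularities`, crux `FInjectiveMacaulayfication`): if a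
  Noetherian local domain of characteristic `p` satisfies the crux's per-stalk clause (every system of
  parameters weakly regular and generating an ideal `I` with
  `(∃ e, y^(p^e) ∈ span {z^(p^e) | z ∈ I}) → y ∈ I`), then for every `x` the principal ideal `(x)`
  satisfies the same implication. Used by the crux's no-go lemma for parameter-ideal blow-up centres.

## References

* [QuyShimomoto2017] P. H. Quy, K. Shimomoto, *F-injectivity and Frobenius closure of ideals in
  Noetherian rings of characteristic p > 0*, Adv. Math. 313 (2017), §3 (parameter F-closed rings).
* [Fedder1983] R. Fedder, *F-purity and rational singularity*, Trans. AMS 278 (1983).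
* [HochsterHuneke1994] Thm. 4.2 (b), proof — the Krull-intersection reduction, as in `FRationalNormal`.
-/

namespace Literature.RingTheory.TightClosure

open IsLocalRing

universe u

variable {R : Type u} [CommRing R]

section ParameterFClosed

variable [IsNoetherianRing R] [IsLocalRing R] [IsDomain R] (p : ℕ) [ExpChar R p]

/-- **Parameter F-closed local domains have Frobenius closed principal ideals.** In a Noetherian local
domain of exponential characteristic `p` in which every ideal generated by a system of parameters is
Frobenius closed, every principal ideal is Frobenius closed: for `0 ≠ x ∈ 𝔪` and systems of
parameters `x, t₂ⁿ, …, t_dⁿ` (`n ≥ 1`), `(x)^F ⊆ ⋂ₙ (x, t₂ⁿ, …, t_dⁿ) ⊆ ⋂ₙ (xR + 𝔪ⁿ) = xR` by Krull's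
intersection theorem in `R/xR`; `(0)^F = 0` in a domain and `(u)^F = (u) = R` for a unit `u`.
[folklore] -/
theorem isFrobeniusClosed_span_singleton_of_parameterFClosed
    (hR : ∀ ⦃d : ℕ⦄ (s : Fin d → R), IsSystemOfParameters s →
      IsFrobeniusClosed p (Ideal.span (Set.range s)))
    (x : R) : IsFrobeniusClosed p (Ideal.span {x}) := by
  classical
  rw [isFrobeniusClosed_iff_le]
  intro y hy
  by_cases hx0 : x = 0
  · -- `(0)^F = 0` in a domain
    subst hx0
    obtain ⟨e, he⟩ := (mem_frobeniusClosure_iff p).mp hy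
    rw [Ideal.span_singleton_zero, frobeniusPower_def, Submodule.bot_coe, Set.image_singleton,
      zero_pow (expChar_pow_pos R p e).ne', Ideal.span_singleton_zero, Ideal.mem_bot] at he
    rw [Ideal.span_singleton_zero, Ideal.mem_bot]
    exact pow_eq_zero_iff (expChar_pow_pos R p e).ne' |>.mp he
  by_cases hxu : IsUnit x
  · rw [Ideal.span_singleton_eq_top.mpr hxu]; trivial
  have hxm : x ∈ maximalIdeal R := (IsLocalRing.mem_maximalIdeal x).mpr hxu
  have hxnzd : x ∈ nonZeroDivisors R := mem_nonZeroDivisors_of_ne_zero hx0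
  -- `dim R = d + 1`
  obtain ⟨d₀, hd₀⟩ := exists_ringKrullDim_eq_nat (R := R)
  obtain ⟨d, rfl⟩ : ∃ d, d₀ = d + 1 := by
    refine Nat.exists_eq_add_one.mpr (Nat.pos_of_ne_zero ?_)
    rintro rfl
    -- `dim R = 0` contradicts `dim (R/xR) + 1 = dim R` with `R/xR` nontrivial
    have hItop : Ideal.span {x} ≠ (⊤ : Ideal R) := fun h =>
      hxu (Ideal.span_singleton_eq_top.mp h)
    haveI : Nontrivial (R ⧸ Ideal.span {x}) := Ideal.Quotient.nontrivial_iff.mpr hItop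
    haveI : IsLocalRing (R ⧸ Ideal.span {x}) :=
      IsLocalRing.of_surjective' (Ideal.Quotient.mk _) Ideal.Quotient.mk_surjective
    obtain ⟨m, hm⟩ := exists_ringKrullDim_eq_nat (R := R ⧸ Ideal.span {x})
    have h := ringKrullDim_quotient_span_singleton_succ_eq_ringKrullDim_of_mem_nonZeroDivisors
      hxnzd hxm
    rw [hd₀, hm] at h
    have h' : m + 1 = 0 := by exact_mod_cast h
    exact Nat.succ_ne_zero m h'
  obtain ⟨t, htm, hsop⟩ := exists_isSystemOfParameters_cons hd₀ hxnzd hxm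
  -- `y ∈ (x) + 𝔪ⁿ` for every `n ≥ 1`
  have hyn : ∀ n : ℕ, 0 < n → y ∈ Ideal.span {x} ⊔ maximalIdeal R ^ n := by
    intro n hn
    set J : Ideal R := Ideal.span (Set.range (Fin.cons x (fun i => t i ^ n) : Fin (d + 1) → R))
    have hJ : IsFrobeniusClosed p J := hR _ (hsop n hn)
    have hxJ : Ideal.span {x} ≤ J :=
      (Ideal.span_singleton_le_iff_mem _).mpr (Ideal.subset_span ⟨0, rfl⟩)
    have hyJ : y ∈ J := ((isFrobeniusClosed_iff_le p).mp hJ) (frobeniusClosure_mono p hxJ hy)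
    refine (Ideal.span_le.mpr ?_ : J ≤ Ideal.span {x} ⊔ maximalIdeal R ^ n) hyJ
    rintro _ ⟨i, rfl⟩
    refine Fin.cases ?_ (fun i => ?_) i
    · exact Ideal.mem_sup_left (Ideal.subset_span (by simp))
    · simpa using Ideal.mem_sup_right (Ideal.pow_mem_pow (htm i) n)
  -- Krull's intersection theorem in `R/xR`
  set I : Ideal R := Ideal.span {x} with hI
  have hItop : I ≠ ⊤ := fun h => hxu (Ideal.span_singleton_eq_top.mp h)
  haveI : Nontrivial (R ⧸ I) := Ideal.Quotient.nontrivial_iff.mpr hItop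
  haveI : IsLocalRing (R ⧸ I) :=
    IsLocalRing.of_surjective' (Ideal.Quotient.mk I) Ideal.Quotient.mk_surjective
  have hmk : (maximalIdeal R).map (Ideal.Quotient.mk I) = IsLocalRing.maximalIdeal (R ⧸ I) :=
    IsLocalRing.map_maximalIdeal_of_surjective _ Ideal.Quotient.mk_surjective
  have hbar : Ideal.Quotient.mk I y ∈ ⨅ n : ℕ, IsLocalRing.maximalIdeal (R ⧸ I) ^ n := by
    refine Ideal.mem_iInf.mpr fun n => ?_
    rcases Nat.eq_zero_or_pos n with rfl | hn
    · rw [pow_zero, Ideal.one_eq_top]; trivial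
    have := Ideal.mem_map_of_mem (Ideal.Quotient.mk I) (hyn n hn)
    rw [Ideal.map_sup, Ideal.map_quotient_self, bot_sup_eq, Ideal.map_pow, hmk] at this
    exact this
  rw [Ideal.iInf_pow_eq_bot_of_isLocalRing _ (maximalIdeal.isMaximal (R ⧸ I)).ne_top,
    Ideal.mem_bot, Ideal.Quotient.eq_zero_iff_mem] at hbar
  exact hbar

end ParameterFClosed

/-- **Principal ideals of an F-injective Cohen–Macaulay stalk are Frobenius closed, inline form**
(the per-stalk clause of route `FrobeniusLadder`, crux `FInjectiveMacaulayfication`): if a Noetherian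
local domain of prime characteristic `p` satisfies "every system of parameters `s` (`dim R` elements
with `rad (s)` maximal) is weakly regular and `(∃ e, y^(p^e) ∈ span {z^(p^e) | z ∈ (s)}) → y ∈ (s)`",
then every principal ideal `(x)` satisfies `(∃ e, y^(p^e) ∈ span {z^(p^e) | z ∈ (x)}) → y ∈ (x)`
(only the Frobenius-closure half of the clause is used). [folklore] -/
theorem span_singleton_frobeniusClosed_of_fInjective_clause (p : ℕ) [Fact p.Prime] {R : Type u}
    [CommRing R] [IsDomain R] [IsNoetherianRing R] [IsLocalRing R] [CharP R p]
    (h : ∀ d : ℕ, ringKrullDim R = d → ∀ s : Fin d → R,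
      (Ideal.span (Set.range s)).radical.IsMaximal →
        RingTheory.Sequence.IsWeaklyRegular R (List.ofFn s) ∧
        ∀ y : R, (∃ e : ℕ, y ^ p ^ e ∈ Ideal.span ((fun z : R => z ^ p ^ e) ''
          (Ideal.span (Set.range s) : Set R))) → y ∈ Ideal.span (Set.range s))
    (x y : R) (hy : ∃ e : ℕ, y ^ p ^ e ∈ Ideal.span ((fun z : R => z ^ p ^ e) ''
      (Ideal.span {x} : Set R))) :
    y ∈ Ideal.span {x} := by
  have hR : ∀ ⦃d : ℕ⦄ (s : Fin d → R), IsSystemOfParameters s →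
      IsFrobeniusClosed p (Ideal.span (Set.range s)) := by
    intro d s hs
    obtain ⟨hd, hmax⟩ := isSystemOfParameters_iff.mp hs
    exact (isFrobeniusClosed_iff p).mpr (h d hd s hmax).2
  exact (isFrobeniusClosed_iff p).mp (isFrobeniusClosed_span_singleton_of_parameterFClosed p hR x) y hy

end Literature.RingTheory.TightClosure
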